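import Literature.NumberTheory.EllipticCurves.ZpExtensionEisensteinOrdinaryInvariantsBoundProofs
import Mathlib.GroupTheory.OrderOfElement
import Mathlib.GroupTheory.Coset.Card
import Mathlib.GroupTheory.QuotientGroup.Basic
import Mathlib.SetTheory.Cardinal.NatCard
import HarnessLib

/-!
# A nilpotent endomorphism of a finite abelian group of order `≤ p^c` whose image swallows `p` vanishes after `c`
# steps (theorems only — no definition, no named fact, no instance, no `sorry`)

Topic `NumberTheory/EllipticCurves` (cell `pub/bsd-print-x9`, shared μ-crux `MuInequalityCoherentPairOfPrint`, registered
stub `stub_h5bAtS`; brick (F4b) of the uniform-`ι` road (design of seat `bsd-line-x9-p1-w3` g6, 2026-08-28T21:10:46Z):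
«`#M ≤ p^c ∧ p·M ⊆ [T]·M ∧ [T]` nilpotent `⇒ [T]^c · M = 0`», the COUNT-TO-EXPONENT conversion by which a numerical
local-duality bound `#H²(K_w, ·) = #Hom_Γ(·, μ) ≤ p^c` (tree `natCard_two_eq_natCard_invariants_homRep`) becomes the
UNIFORM annihilation of `H²(K_w, Fil_i)`, `H²(K_w, T/π^iT)` by `[T]^c` that the one-step torsion readout of Howard's
condition `F_𝔮` at `w ∣ p` needs (obstructions to lifting and the cokernel of `H¹(T/π^i) → H¹(gr_w)`)).

Pure group theory.  For a finite abelian group `M` and commuting additive endomorphisms `φ, ψ` with `p · x = φ (ψ x)`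
(`p` prime; in the application `φ = [T]·`, `ψ = −[T]^{m−1}·`, as `p = −[T]^m` in `A_{m,k} = Λ/(T^m + p, p^k)`) and `φ`
nilpotent:

* `iterate_apply_eq_zero_of_natCard_le_pow` — **if `#M ≤ p^c` then `φ^c = 0`**.  Induction on `c` through the image
  `φ(M)`: when `M ≠ 0` the kernel of `φ` contains a non-zero element (nilpotency) and is killed by `p`
  (`p x = ψ (φ x)`), so it has an element of order `p` and `#ker φ ≥ p`, whence `#φ(M) = #M / #ker φ ≤ p^{c−1}`.
* `pow_smul_eq_zero_of_natCard_le_pow` — module form: `π a : A` with `(p : A) = π·a`, `π` nilpotent on the finite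
  `A`-module `M`, `#M ≤ p^c` ⇒ `π^c • M = 0`.
* `IwasawaAlgebra.EisensteinCoeff.mk_X_pow_smul_eq_zero_of_natCard_le_pow` — the instance `A = A_{m,k}`
  (`m ≥ 1`), `π = [T]`: every finite `A_{m,k}`-module of order `≤ p^c` is killed by `[T]^c`.

References: [Howard2004HeegnerKolyvagin] B. Howard, Compositio Math. 140 (2004), §2.2 and proof of Thm. 2.2.10 («taking
`𝔮 = T^m + p`»: `S_𝔮` is a DVR with `π^m = −p`), §3.1 (the local conditions at `v ∣ p`); [MilneADT2006] I Cor. 2.3 (the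
numerical local duality this lemma converts); [Washington1997] §13.2 (`Λ/(f, p^k)` finite).  No summit statement is
proved; BSD is not proved by any of this.
-/

set_option autoImplicit false

noncomputable section

open Function

universe u v

namespace Literature.NumberTheory.EllipticCurves

/-! ## §1 Finite abelian groups: commuting endomorphisms `φ, ψ` with `p = φ ∘ ψ`, `φ` nilpotent -/

/-- The kernel of a nilpotent endomorphism of a non-trivial group is non-trivial: some `y ≠ 0` has `φ y = 0` (the last
non-zero iterate of a non-zero element). [cite: Washington1997, §13.2 (nilpotence of T on Λ/(f, p^k)-modules)] -/
theorem exists_ne_zero_apply_eq_zero_of_iterate_eq_zero {M : Type v} [AddCommGroup M] [Nontrivial M] (φ : M →+ M)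
    (hnil : ∃ n : ℕ, ∀ x : M, φ^[n] x = 0) : ∃ y : M, y ≠ 0 ∧ φ y = 0 := by
  classical
  obtain ⟨x, hx⟩ := exists_ne (0 : M)
  obtain ⟨n, hn⟩ := hnil
  have hex : ∃ j : ℕ, φ^[j] x = 0 := ⟨n, hn x⟩
  have hj0 : Nat.find hex ≠ 0 := by
    intro h0
    have h := Nat.find_spec hex
    rw [h0, iterate_zero_apply] at h
    exact hx h
  obtain ⟨j, hj⟩ := Nat.exists_eq_succ_of_ne_zero hj0
  refine ⟨φ^[j] x, ?_, ?_⟩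
  · have hmin := Nat.find_min hex (m := j) (by rw [hj]; exact Nat.lt_succ_self j)
    exact hmin
  · rw [← iterate_succ_apply' φ j x, ← hj]
    exact Nat.find_spec hex

/-- **The kernel of `φ` has at least `p` elements** when `M ≠ 0` is finite, `φ` is nilpotent and `p · x = ψ (φ x)` for an
endomorphism `ψ`: a non-zero element of `ker φ` is killed by the prime `p`, hence has order `p`, which divides `#ker φ`.
[cite: Washington1997, §13.2] -/
theorem prime_le_natCard_ker_of_iterate_eq_zero {M : Type v} [AddCommGroup M] [Finite M] [Nontrivial M] {p : ℕ}
    (hp : p.Prime) (φ ψ : M →+ M) (hpφ : ∀ x : M, p • x = ψ (φ x)) (hnil : ∃ n : ℕ, ∀ x : M, φ^[n] x = 0) :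
    p ≤ Nat.card φ.ker := by
  obtain ⟨y, hy0, hy⟩ := exists_ne_zero_apply_eq_zero_of_iterate_eq_zero φ hnil
  have hpy : p • y = 0 := by rw [hpφ, hy, map_zero]
  have hord : addOrderOf y = p := by
    rcases (Nat.dvd_prime hp).mp (addOrderOf_dvd_of_nsmul_eq_zero hpy) with h1 | h
    · exact absurd (AddMonoid.addOrderOf_eq_one_iff.mp h1) hy0
    · exact h
  have hmem : y ∈ φ.ker := (AddMonoidHom.mem_ker).mpr hy
  have hdvd : p ∣ Nat.card φ.ker := by
    have h := addOrderOf_dvd_natCard (⟨y, hmem⟩ : φ.ker)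
    rwa [← AddSubgroup.addOrderOf_coe (⟨y, hmem⟩ : φ.ker), AddSubgroup.coe_mk, hord] at h
  haveI : Nonempty φ.ker := ⟨0⟩
  exact Nat.le_of_dvd Nat.card_pos hdvd

/-- **`#M ≤ p^c ⇒ φ^c = 0`** for a finite abelian group `M` with commuting endomorphisms `φ, ψ` such that
`p · x = φ (ψ x)` (`p` prime) and `φ` nilpotent.  (Induction on `c` through `φ(M)`: `#φ(M) = #M / #ker φ ≤ p^{c−1}` by
`prime_le_natCard_ker_of_iterate_eq_zero`; in the application `φ = [T]·` on a finite `Λ/(T^m + p, p^k)`-module, `p = −[T]^m`.)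
[cite: Howard2004HeegnerKolyvagin, §2.2 and proof of Thm. 2.2.10 (π^m = −p in S_𝔮)] [cite: Washington1997, §13.2] -/
theorem iterate_apply_eq_zero_of_natCard_le_pow {p : ℕ} (hp : p.Prime) (c : ℕ) :
    ∀ {M : Type v} [AddCommGroup M] [Finite M] (φ ψ : M →+ M), (∀ x : M, φ (ψ x) = ψ (φ x)) →
      (∀ x : M, p • x = φ (ψ x)) → (∃ n : ℕ, ∀ x : M, φ^[n] x = 0) → Nat.card M ≤ p ^ c →
      ∀ x : M, φ^[c] x = 0 := by
  induction c with
  | zero =>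
    intro M _ _ φ ψ _ _ _ hcard x
    rw [pow_zero] at hcard
    haveI : Subsingleton M := Finite.card_le_one_iff_subsingleton.mp hcard
    rw [Subsingleton.elim x 0, iterate_map_zero]
  | succ c ih =>
    intro M _ _ φ ψ hcomm hpφ hnil hcard x
    by_cases hM : Subsingleton M
    · rw [Subsingleton.elim x 0, iterate_map_zero]
    haveI : Nontrivial M := not_subsingleton_iff_nontrivial.mp hM
    -- the restrictions of `φ`, `ψ` to the image `R = φ(M)`
    let R : AddSubgroup M := φ.range
    have hφR : ∀ r : R, φ r ∈ R := fun r ↦ ⟨r, rfl⟩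
    have hψR : ∀ r : R, ψ r ∈ R := by
      rintro ⟨_, y, rfl⟩
      exact ⟨ψ y, hcomm y⟩
    let φ' : R →+ R := (φ.comp R.subtype).codRestrict R (fun r ↦ hφR r)
    let ψ' : R →+ R := (ψ.comp R.subtype).codRestrict R (fun r ↦ hψR r)
    have hφ' : ∀ r : R, ((φ' r : R) : M) = φ r := fun r ↦ rfl
    have hψ' : ∀ r : R, ((ψ' r : R) : M) = ψ r := fun r ↦ rfl
    have hiter : ∀ (n : ℕ) (r : R), ((φ'^[n] r : R) : M) = φ^[n] (r : M) := by
      intro n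
      induction n with
      | zero => intro r; rfl
      | succ n ihn => intro r; rw [iterate_succ_apply', iterate_succ_apply', hφ', ihn]
    have hcomm' : ∀ r : R, φ' (ψ' r) = ψ' (φ' r) := fun r ↦ Subtype.ext (by rw [hφ', hψ', hψ', hφ', hcomm])
    have hpφ' : ∀ r : R, p • r = φ' (ψ' r) := fun r ↦ Subtype.ext (by
      rw [AddSubgroup.coe_nsmul, hφ', hψ', hpφ])
    have hnil' : ∃ n : ℕ, ∀ r : R, φ'^[n] r = 0 := by
      obtain ⟨n, hn⟩ := hnil
      exact ⟨n, fun r ↦ Subtype.ext (by rw [hiter, hn]; rfl)⟩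
    -- the count `#R · p ≤ #M ≤ p^(c+1)`
    have hker : p ≤ Nat.card φ.ker :=
      prime_le_natCard_ker_of_iterate_eq_zero hp φ ψ (fun y ↦ by rw [hpφ, hcomm]) hnil
    have hM : Nat.card M = Nat.card R * Nat.card φ.ker := by
      rw [AddSubgroup.card_eq_card_quotient_mul_card_addSubgroup φ.ker,
        Nat.card_congr (QuotientAddGroup.quotientKerEquivRange φ).toEquiv]
    have hR : Nat.card R ≤ p ^ c := by
      have h1 : Nat.card R * p ≤ p ^ c * p := by
        calc Nat.card R * p ≤ Nat.card R * Nat.card φ.ker := Nat.mul_le_mul_left _ hker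
          _ = Nat.card M := hM.symm
          _ ≤ p ^ (c + 1) := hcard
          _ = p ^ c * p := pow_succ p c
      exact Nat.le_of_mul_le_mul_right h1 hp.pos
    -- induction hypothesis on `R`, applied to `φ x ∈ R`
    have hIH := ih φ' ψ' hcomm' hpφ' hnil' hR ⟨φ x, x, rfl⟩
    have h := congrArg (fun r : R ↦ (r : M)) hIH
    rw [hiter] at h
    rw [iterate_succ_apply]
    exact h

/-! ## §2 Module forms -/

/-- **Module form**: for a commutative ring `A`, elements `π a : A` with `(p : A) = π · a` (`p` prime), and a finite
`A`-module `M` on which `π` is nilpotent, `#M ≤ p^c` implies `π^c • x = 0` for every `x ∈ M`.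
[cite: Howard2004HeegnerKolyvagin, §2.2 and proof of Thm. 2.2.10 (π^m = −p in S_𝔮)] [cite: Washington1997, §13.2] -/
theorem pow_smul_eq_zero_of_natCard_le_pow {A : Type u} [CommRing A] {p : ℕ} (hp : p.Prime) (π a : A)
    (hpa : (p : A) = π * a) {M : Type v} [AddCommGroup M] [Module A M] [Finite M]
    (hnil : ∃ n : ℕ, ∀ x : M, π ^ n • x = 0) {c : ℕ} (hcard : Nat.card M ≤ p ^ c) (x : M) : π ^ c • x = 0 := by
  let φ : M →+ M := DistribSMul.toAddMonoidHom M π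
  let ψ : M →+ M := DistribSMul.toAddMonoidHom M a
  have hφ : ∀ y : M, φ y = π • y := fun _ ↦ rfl
  have hψ : ∀ y : M, ψ y = a • y := fun _ ↦ rfl
  have hiter : ∀ (n : ℕ) (y : M), φ^[n] y = π ^ n • y := by
    intro n
    induction n with
    | zero => intro y; rw [iterate_zero_apply, pow_zero, one_smul]
    | succ n ihn => intro y; rw [iterate_succ_apply', ihn, hφ, smul_smul, ← pow_succ']
  have hcomm : ∀ y : M, φ (ψ y) = ψ (φ y) := fun y ↦ by rw [hφ, hψ, hψ, hφ, smul_smul, smul_smul, mul_comm]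
  have hpφ : ∀ y : M, p • y = φ (ψ y) := fun y ↦ by
    rw [hφ, hψ, smul_smul, ← hpa, Nat.cast_smul_eq_nsmul]
  have hnil' : ∃ n : ℕ, ∀ y : M, φ^[n] y = 0 := by
    obtain ⟨n, hn⟩ := hnil
    exact ⟨n, fun y ↦ by rw [hiter, hn]⟩
  rw [← hiter]
  exact iterate_apply_eq_zero_of_natCard_le_pow hp c φ ψ hcomm hpφ hnil' hcard x

namespace IwasawaAlgebra.EisensteinCoeff

variable (p : ℕ) [hp : Fact p.Prime]

/-- **Instance `A = A_{m,k} = Λ/(T^m + p, p^k)`, `π = [T]`** (`m ≥ 1`): every finite `A_{m,k}`-module of order `≤ p^c` is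
killed by `[T]^c` (`p = −[T]^m = [T]·(−[T]^{m−1})`, `[T]` nilpotent in `A_{m,k}`).  With `M = H²(K_w, Fil_i)` or
`H²(K_w, T/π^iT)` (order `= #Hom_Γ(·, μ)` by local duality) this is the uniform `H²`-exponent of the uniform-`ι` road.
[cite: Howard2004HeegnerKolyvagin, §2.2, proof of Thm. 2.2.10 and §3.1] [cite: Washington1997, §13.2] -/
theorem mk_X_pow_smul_eq_zero_of_natCard_le_pow {m : ℕ} (hm : 1 ≤ m) (k : ℕ) {M : Type v} [AddCommGroup M]
    [Module (EisensteinCoeff p m k) M] [Finite M] {c : ℕ} (hcard : Nat.card M ≤ p ^ c) (x : M) :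
    ((Ideal.Quotient.mk _ PowerSeries.X : EisensteinCoeff p m k) ^ c) • x = 0 := by
  have hpa : ((p : ℕ) : EisensteinCoeff p m k) =
      (Ideal.Quotient.mk _ PowerSeries.X : EisensteinCoeff p m k) *
        (-(Ideal.Quotient.mk _ PowerSeries.X : EisensteinCoeff p m k) ^ (m - 1)) := by
    rw [natCast_eq_neg_mk_X_pow p m k, mul_neg, ← pow_succ', Nat.sub_add_cancel hm]
  obtain ⟨n, hn⟩ := isNilpotent_mk_X p m k
  refine pow_smul_eq_zero_of_natCard_le_pow hp.out _ _ hpa ⟨n, fun y ↦ ?_⟩ hcard x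
  rw [hn, zero_smul]

end IwasawaAlgebra.EisensteinCoeff

end Literature.NumberTheory.EllipticCurves
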